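import Literature.AlgebraicGeometry.Hyperkaehler.KugaSatakeCorrespondenceHyperkaehler
import Literature.AlgebraicGeometry.Hyperkaehler.K3HilbertType
import HarnessLib

/-!
# The transcendental lattice of a projective `K3^[n]`-type variety has signature `(2, r − 2)` for the
# Beauville–Bogomolov form (Beauville 1983 Thm. 5; Huybrechts 1999 §1.9 + Hodge index) — read on a presentation
# of the transcendental part — NAMED FACT (+ proved repackagings)

Family `hodge`, layer `Literature/AlgebraicGeometry/Hyperkaehler`. Written for the cell `hodge-nonav` (planner memo
ROUTE-P3v20-g29-ADD1 §H1, sketch `p3/hosts-g29/RankEighteenHKSketch.lean` r2, typed ask **W2-HK** =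
`TranscendentalK3TypeBasisHK`: the HK twin of the K3-surface fact `Surfaces.Huybrechts2016_K3_transcendentalLattice_signature`).
ONE named fact (D-0026: `+1`, a published theorem cited at the line) and proved repackagings; no definition, no
instance.

## Sources (held text `paper:arxiv-alg-geom_9705025` = Huybrechts, *Compact hyperkähler manifolds: basic
## results*, Invent. Math. 135 (1999), §1.9; page-confirmed 2026-08-28, PDF pages of the arXiv text)

* §1.9 (p0004 L110 – p0005 L38), verbatim: "Due to work of Beauville [Beauville1] there exists a natural quadratic
  form on the second cohomology of an irreducible symplectic manifold generalizing the intersection pairing on a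
  K3 surface. […] Clearly, with respect to this quadratic form `H^{1,1}(X)` is orthogonal to
  `H^{2,0}(X) ⊕ H^{0,2}(X)`. Moreover, `f(σ) = 0` and `f(σ + σ̄) = 1 > 0`. If `α` is a Kähler class on `X` and
  `F = F(α)`, then the decomposition `H²(X, ℝ) = F ⊕ H²(X, ℝ)_F` is orthogonal with respect to `f`. […] Hence:
  For any Kähler class `α` the quadratic form `f` restricted to `F(α)` is positive definite. […] Thus `f`
  restricted to `H²(X, ℝ)_F` is a positive multiple of the standard Hodge–Riemann bilinear form and, therefore,
  negative definite. […] The upshot is: There exists a positive constant `c ∈ ℝ` such that `q_X := c · f` is a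
  primitive integral quadratic form on `H²(X, ℤ)` of index `(3, b₂(X) − 3)`." Here
  `F(α) = ℝα ⊕ (H^{2,0} ⊕ H^{0,2})(X)_ℝ` (§1.8).
* [Beauville1983] Thm. 5 (the form `q_X`, non-degenerate of signature `(3, b₂ − 3)`), the original.
* §3 (p0012 L17): "`X` is projective if and only if `X` admits a Kähler form `ω` such that its cohomology class
  is integral" — a projective `X` has an integral Kähler (ample) class `α ∈ NS(X)`.

Consequence (the standard reading, e.g. for K3 surfaces Huybrechts' K3 book Ch. 3 Lemma 3.1): for PROJECTIVE `X` the
transcendental lattice `T(X) = NS(X)^⊥ ⊂ H²(X, ℚ)` contains `(H^{2,0} ⊕ H^{0,2})_ℝ` after tensoring with `ℝ`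
(Hodge classes are of type `(1,1)`, orthogonal to `H^{2,0}`), on which `q_X` is positive definite, and
`T(X) ∩ H^{1,1}` lies in `α^⊥ ∩ H^{1,1}(X)_ℝ ⊂ H²(X, ℝ)_{F(α)}`, on which `q_X` is negative definite: `q_X|_{T(X)}` is
non-degenerate of signature `(2, r − 2)`, `r = rank T(X) = b₂(X) − ρ(X)` (`= 23 − ρ(X)` for `K3^[n]`-type, `n ≥ 2`).

## Rendering (the cell's presentation language, `KugaSatakeCorrespondenceHyperkaehler`)

A presentation `(T, H, P, j)` of the transcendental part of `X` (`IsTranscendentalPartHK hX M hM b H P j`) is a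
polarized weight-`2` rational Hodge structure `(H, P)` on `T` with an injective morphism `j : H → H²(X, ℚ)` onto
the `b`-orthogonal of the Hodge classes, `b` a Fujiki form (`IsFujikiForm n X b`: the Beauville–Bogomolov form up
to a scalar, §1.11), with `P(t, t') = b(j t, j t')`. The tree's `HodgeStructure.Polarization` CARRIES both
Hodge–Riemann relations (`form_apply_eq_zero`, `pos`; weight `2`, untwisted: `−P_ℂ(x, x̄) > 0` on `T^{2,0} ⊕ T^{0,2}`,
`P_ℂ(x, x̄) > 0` on `T^{1,1}`), so `−P ⊗ ℝ` has signature `(2 h^{2,0}(T), h^{1,1}(T))`; the printed input beyond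
the structure fields is `h^{2,0}(T(X)) = 1` (`H^{2,0}(X) = ℂσ ⊂ T(X) ⊗ ℂ`, §1.9 "f(σ + σ̄) > 0" and `b₂`-bookkeeping)
together with Sylvester's law of inertia over a `ℚ`-orthogonal basis. STATEMENT: `(T, −P)` has an orthogonal
`ℚ`-basis `e : Fin r → T` with `−P(eᵢ, eₖ) = δᵢₖ wᵢ`, `w₀, w₁ > 0`, `wᵢ < 0` for `i ≥ 2` (signature `(2, r − 2)` in
diagonal form) — symbol for symbol the sketch's `TranscendentalK3TypeBasisHK` with `IsK3TypeWeights` unfolded.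

## What is proved here

* `….weights_ne_zero`, `….exists_basis_rank_le` — non-vanishing of the weights; the consumer shape «if
  `dim_ℚ T ≤ k` then the basis has `r ≤ k` members» (the sketch's `hrank` step).

## What is NOT here (discharge road, recorded)

(1) `h^{2,0} = 1` for the transcendental part of a projective `K3^[n]`-type variety on the tree's carriers
(`IsOfK3HilbertType` is deformation equivalence to `S^[n]`; Hodge numbers of `S^[n]`, Göttsche; invariance under
deformation); (2) the linear algebra «polarized weight-2 `ℚ`-Hodge structure with `h^{2,0} = 1` ⇒ `−Q` has an
orthogonal `ℚ`-basis of signature `(2, r − 2)`» (Gram–Schmidt over `ℚ`, `LinearMap.BilinForm.exists_orthogonal_basis`,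
+ Sylvester via the tree's `NumberTheory.QuadraticForms.real_diagIsometric_iff`). Both are theorems in print; (2)
is the natural in-tree lemma that would also discharge the K3-surface twin.

## References

* [Huybrechts1999] D. Huybrechts, Compact hyperkähler manifolds: basic results, Invent. Math. 135 (1999) 63–113
  (arXiv alg-geom/9705025): §1.9 (p0004 L110 – p0005 L38), §1.11, §3 (p0012 L17).
* [Beauville1983] A. Beauville, Variétés kählériennes dont la première classe de Chern est nulle, J. Differential
  Geom. 18 (1983), Thm. 5 and §8–§9.
* [Floccari2024] S. Floccari, §5.1 (the presentation language `IsTranscendentalPartHK`).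

## Provenance

Cell `hodge-nonav` (summit `HodgeConjecture`, rung F-H1), memo ROUTE-P3v20-g29-ADD1 §H1 (P3 g29), W2-HK; seat
`littype-FH1-2` (literature-prover, generation 17).
-/

noncomputable section

open Literature.AlgebraicTopology.SingularHomology

namespace Literature.AlgebraicGeometry.Hyperkaehler

open HodgeTheory
open Motives (SchemeOver IsSmoothProjective HodgeStructure)

/-- **Beauville 1983 Thm. 5 / Huybrechts 1999 §1.9 with Hodge index, on a presentation of the transcendental part
(W2-HK)**: for a smooth projective `X` of `K3^[n]`-type (`n ≥ 2`), a Fujiki form `b`, a Hodge-symmetric model `M`,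
and a presentation `(T, H, P, j)` of the transcendental part (`IsTranscendentalPartHK`), the form `−P` on `T`
admits an orthogonal `ℚ`-basis `e : Fin r → T` with weights `w`, `w i > 0` for `i < 2` and `w i < 0` for
`i ≥ 2`: the rational transcendental lattice is a non-degenerate quadratic space of signature `(2, r − 2)`
("`q_X` […] of index `(3, b₂(X) − 3)`"; "`f` restricted to `F(α)` is positive definite […] restricted to
`H²(X, ℝ)_F` […] negative definite", `α` an ample class of the projective `X`). Named fact (D-0014); see the
module docstring for the rendering and the discharge road. [cite: Huybrechts1999, §1.9 (arXiv p0004 L110 – p0005 L38) and §3 (p0012 L17)]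
[cite: Beauville1983, Thm. 5] -/
def Huybrechts1999_k3HilbertType_transcendentalPart_signature : Prop :=
  ∀ (n : ℕ), 2 ≤ n → ∀ ⦃X : SchemeOver ℂ⦄ (hX : IsSmoothProjective (2 * n) X), IsOfK3HilbertType n X →
    ∀ (b : complexBetti X 2 →ₗ[ℂ] complexBetti X 2 →ₗ[ℂ] ℂ), IsFujikiForm n X b →
    ∀ (M : HodgeModel (2 * n) X) (hM : M.IsHodgeSymmetric)
      (T : Type) [AddCommGroup T] [Module ℚ T] (H : HodgeStructure T 2) (P : H.Polarization)
      (j : H.Hom (bettiTwoHodgeStructureOfModel hX M hM)),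
      IsTranscendentalPartHK hX M hM b H P j →
    ∃ (r : ℕ) (e : Module.Basis (Fin r) ℚ T) (w : Fin r → ℚ),
      (∀ i : Fin r, (i.val < 2 → 0 < w i) ∧ (2 ≤ i.val → w i < 0)) ∧
      ∀ i k, -(P.form (e i) (e k)) = if i = k then w i else 0

namespace Huybrechts1999_k3HilbertType_transcendentalPart_signature

/-- K3-type weights are non-zero. [cite: Huybrechts1999, §1.9] -/
theorem weights_ne_zero {r : ℕ} {w : Fin r → ℚ} (hw : ∀ i : Fin r, (i.val < 2 → 0 < w i) ∧ (2 ≤ i.val → w i < 0))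
    (i : Fin r) : w i ≠ 0 := by
  rcases Nat.lt_or_ge i.val 2 with h | h
  · exact ((hw i).1 h).ne'
  · exact ((hw i).2 h).ne

/-- **Consumer shape** (the sketch's `hrank` step): granted the fact, if `dim_ℚ T ≤ k` then the orthogonal basis has
`r ≤ k` members (a basis indexed by `Fin r` has `r = dim_ℚ T`). [cite: Huybrechts1999, §1.9] -/
theorem exists_basis_rank_le (hSig : Huybrechts1999_k3HilbertType_transcendentalPart_signature)
    {n : ℕ} (hn : 2 ≤ n) {X : SchemeOver ℂ} (hX : IsSmoothProjective (2 * n) X) (hK : IsOfK3HilbertType n X)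
    {b : complexBetti X 2 →ₗ[ℂ] complexBetti X 2 →ₗ[ℂ] ℂ} (hb : IsFujikiForm n X b)
    {M : HodgeModel (2 * n) X} {hM : M.IsHodgeSymmetric}
    {T : Type} [AddCommGroup T] [Module ℚ T] {H : HodgeStructure T 2} {P : H.Polarization}
    {j : H.Hom (bettiTwoHodgeStructureOfModel hX M hM)} (hT : IsTranscendentalPartHK hX M hM b H P j)
    {k : ℕ} (hrank : Module.finrank ℚ T ≤ k) :
    ∃ (r : ℕ), r ≤ k ∧ ∃ (e : Module.Basis (Fin r) ℚ T) (w : Fin r → ℚ),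
      (∀ i : Fin r, (i.val < 2 → 0 < w i) ∧ (2 ≤ i.val → w i < 0)) ∧
      ∀ i k, -(P.form (e i) (e k)) = if i = k then w i else 0 := by
  obtain ⟨r, e, w, hw, hgram⟩ := hSig n hn hX hK b hb M hM T H P j hT
  have h1 : Module.finrank ℚ T = r := by simpa using Module.finrank_eq_card_basis e
  exact ⟨r, by omega, e, w, hw, hgram⟩

end Huybrechts1999_k3HilbertType_transcendentalPart_signature

end Literature.AlgebraicGeometry.Hyperkaehler

end
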